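import Literature.MathematicalPhysics.QuantumLattice.ChargeTransportIndex
import Literature.MathematicalPhysics.QuantumLattice.HubbardTorusChargeFluctuations
import Literature.MathematicalPhysics.QuantumLattice.HubbardHubbardModelEtaPairingProofs
import HarnessLib

/-!
# The Lieb–Schultz–Mattis filling constraint on the Hubbard torus with an explicit rate
# (Bachmann–Bols–De Roeck–Fraas, Theorem 2.1 with Proposition 2.4 and §3.2, quantitative form)

The named fact `bbdf2019_lsm_filling_hubbardTorus` (`HubbardLSMFilling.lean`) is proved in the tree
(`HubbardLSMFillingHolds.lean`) in its `∀ k ∃ C` form. This file records the EXPLICIT-CONSTANT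
version obtained by instantiating the generic index theorem
`exists_int_abs_expect_plane_sub_le_of_regime` of `ChargeTransportIndex.lean` (BBDF §4 for a strict
translation symmetry, with the Lieb–Robinson/quasi-adiabatic input of Proposition 2.4 made
quantitative) on the fermionic torus `ℤ_L^d`:

* `lsmSetting_hubbardTorus` — for `L ≥ lsmL0 (2d) t U μ = 128(⌈κ⌉₊ + 1)` (`κ` the Lieb–Robinson
  rate), the Hubbard torus with the coordinate `x_{i₀}`, the unit translation `siteShift i₀`
  (a symmetry of `H`, BBDF's `U`), maximal degree `2d` and `γ = g` is an `LSMSetting`;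
* `hubbardTorus_filling_near_int_of_regime` — in that regime the column fillings `N_σ/L`
  (`N_↑ = N/2 + M`, `N_↓ = N/2 - M`) of the unique gapped ground state in the sector `szSector N M`
  are within `lsmConst (2d) d t U μ g g k / L^k` of an integer, for every `k`
  (`⟨ψ, Q^σ_{[0]} ψ⟩ = N_σ/L` by translation invariance, `expect_setCharge_slab_zero`, BBDF §3.2);
* `hubbardTorus_filling_near_int` — the same for every even or odd side `L ≥ 1`, with the constant
  `max (lsmConst …) (L₀^k/2)` (the sides `L < L₀` being trivial).

Instance note: the `DecidableEq`-type instance arguments of `HasSpectralGap`/`IsGroundStateVector`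
synthesised for the concrete torus differ (by subsingleton instances) from the ones the generic
theorem carries; they are bridged with `convert` in `lsmSetting_hubbardTorus`. Theorems only.

## References

* S. Bachmann, A. Bols, W. De Roeck, M. Fraas, Comm. Math. Phys. **375** (2019) 1249–1272,
  arXiv:1810.07351: Theorem 2.1, Proposition 2.4, §3.2 (Example 2). [BachmannEtAl2019]
* The tree: `ChargeTransportIndex` (`LSMSetting.of_regime`, `exists_int_abs_expect_plane_sub_le_of_regime`,
  `lsmConst`, `lsmL0`), `HubbardTorusCharges` (`coordZ`, `siteShift`, `expect_setCharge_slab_zero`),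
  `HubbardTorusChargeFluctuations` (`exists_coordZ_eq`), `HubbardHubbardModelEtaPairingProofs`
  (`card_fermionTorus`), `HubbardLSMFillingProofs` (`card_filter_fermionTorusGraph_adj_le`).
-/

noncomputable section

namespace Literature.MathematicalPhysics.QuantumLattice

open Matrix Complex Finset HubbardWave0
open scoped ComplexOrder

section TorusRate

open FermionTorus

variable {d L : ℕ} [NeZero L]

/-- **The Hubbard torus in the regime `L ≥ L₀` is an `LSMSetting`** (coordinate `x_{i₀}`,
translation by `e_{i₀}`, maximal degree `2d`, `γ = g`). [cite: BachmannEtAl2019, §3.2 and Proposition 2.4] -/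
theorem lsmSetting_hubbardTorus (i₀ : Fin d) {t U μ g : ℝ} (hg : 0 < g) (hL : lsmL0 (2 * d) t U μ ≤ L)
    (hgap : (hubbardTorusWith d L t U μ).HasSpectralGap g) {ψ : Fock (Orb (FermionTorus d L))}
    (hψ : (hubbardTorusWith d L t U μ).IsGroundStateVector ψ) (hψ1 : star ψ ⬝ᵥ ψ = 1) :
    LSMSetting (fermionTorusGraph d L) (coordZ i₀) (siteShift i₀) t U μ g (L / 2) (L / 8) (L / 16) (2 * d) g ψ := by
  have hsymm : relabelOp (Orb.mapEquiv (siteShift i₀)) * hamiltonianWith (fermionTorusGraph d L) t U μ =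
      hamiltonianWith (fermionTorusGraph d L) t U μ * relabelOp (Orb.mapEquiv (siteShift i₀)) := by
    have h := transOp_mul_hubbardTorusWith (L := L) i₀ t U μ
    rw [transOp, hubbardTorusWith, lsmShift_eq_mapEquiv] at h
    exact h
  have hdeg : ∀ x : FermionTorus d L, (Finset.univ.filter fun y => (fermionTorusGraph d L).Adj x y).card ≤ 2 * d :=
    fun x => card_filter_fermionTorusGraph_adj_le x
  have hcf : IsCoordFn (coordZ i₀) (fermionTorusGraph d L) := fun _ _ h => coordZ_rel_of_adj i₀ h
  rw [hubbardTorusWith] at hgap hψ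
  -- the instance arguments of `HasSpectralGap`/`IsGroundStateVector` synthesised for the concrete torus
  -- differ (by subsingleton instances) from the generic ones: bridge them with `convert`
  refine LSMSetting.of_regime (fermionTorusGraph d L) (coordZ i₀) (siteShift i₀) t U μ g hL
    hcf (coordZ_siteShift i₀) hdeg (exists_coordZ_eq i₀) hsymm hg le_rfl ?_ ?_ hψ1
  · convert hgap using 3
  · convert hψ using 3

/-- **The plane charge of the normalised ground state is `N_σ/L`-close to an integer, `O(L^{-k})`**
(regime `L ≥ L₀`). [cite: BachmannEtAl2019, Theorem 2.1, Proposition 2.4 and §3.2] -/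
theorem hubbardTorus_filling_near_int_of_regime (hd : 1 ≤ d) {t U μ g : ℝ} (hg : 0 < g)
    (hL : lsmL0 (2 * d) t U μ ≤ L) (hgap : (hubbardTorusWith d L t U μ).HasSpectralGap g)
    {ψ : Fock (Orb (FermionTorus d L))} (hψ : (hubbardTorusWith d L t U μ).IsGroundStateVector ψ)
    {N : ℕ} {M : ℝ} (hmem : ψ ∈ szSector N M) (σ : Fin 2) (k : ℕ) :
    ∃ n : ℤ, |(if σ = 0 then (N : ℝ) / 2 + M else (N : ℝ) / 2 - M) / L - n| ≤
      lsmConst (2 * d) d t U μ g g k / (L : ℝ) ^ k := by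
  set i₀ : Fin d := ⟨0, hd⟩
  -- normalise the ground state
  have hψ0 : ψ ≠ 0 := hψ.1
  have hn0 : eucNorm ψ ≠ 0 := by
    intro h0
    apply hψ0
    have : (WithLp.toLp 2 ψ : EuclideanSpace ℂ (Finset (Orb (FermionTorus d L)))) = 0 := norm_eq_zero.1 h0
    exact (WithLp.toLp_eq_zero (p := 2)).1 this
  set c : ℂ := (((eucNorm ψ)⁻¹ : ℝ) : ℂ) with hc
  have hc0 : c ≠ 0 := by rw [hc]; exact_mod_cast inv_ne_zero hn0
  set ψ₁ : Fock (Orb (FermionTorus d L)) := c • ψ with hψ₁def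
  have hψ₁1 : star ψ₁ ⬝ᵥ ψ₁ = 1 := by
    rw [hψ₁def, star_smul, smul_dotProduct, dotProduct_smul, star_dotProduct_self_eq_eucNorm_sq, hc, smul_eq_mul,
      smul_eq_mul, Complex.star_def, Complex.conj_ofReal]
    push_cast
    field_simp
  have hψ₁ : (hubbardTorusWith d L t U μ).IsGroundStateVector ψ₁ :=
    ⟨smul_ne_zero hc0 hψ0, by rw [hψ₁def, mulVec_smul, hψ.2, smul_comm]⟩
  have hmem₁ : ψ₁ ∈ szSector N M := Submodule.smul_mem _ c hmem
  have hs := lsmSetting_hubbardTorus i₀ hg hL hgap hψ₁ hψ₁1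
  obtain ⟨n, hn⟩ := exists_int_abs_expect_plane_sub_le_of_regime (σ := σ) hs hL (dd := d) (card_fermionTorus d L).le k
  have e : cslab (coordZ i₀) (zrange 0 1) = slab i₀ ({(0 : ZMod L)} : Finset (ZMod L)) := by
    ext x; simp [mem_cslab, mem_slab, zrange_one]
  have hval : star ψ₁ ⬝ᵥ (setCharge σ (cslab (coordZ i₀) (zrange 0 1)) *ᵥ ψ₁) =
      ((((if σ = 0 then (N : ℝ) / 2 + M else (N : ℝ) / 2 - M) / L : ℝ)) : ℂ) := by
    rw [e, expect_setCharge_slab_zero i₀ hgap hψ₁ hmem₁ σ, hψ₁1, mul_one]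
  rw [hval, Complex.ofReal_re] at hn
  exact ⟨n, hn⟩

/-- **The filling constraint with an explicit constant, for every side `L ≥ 1`**:
`dist(N_σ/L, ℤ) ≤ max(lsmConst, L₀^k/2)/L^k` (the sides `L < L₀` are trivial since
`dist(x, ℤ) ≤ 1/2`). [cite: BachmannEtAl2019, Theorem 2.1, Proposition 2.4 and §3.2] -/
theorem hubbardTorus_filling_near_int (hd : 1 ≤ d) {t U μ g : ℝ} (hg : 0 < g)
    (hgap : (hubbardTorusWith d L t U μ).HasSpectralGap g)
    {ψ : Fock (Orb (FermionTorus d L))} (hψ : (hubbardTorusWith d L t U μ).IsGroundStateVector ψ)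
    {N : ℕ} {M : ℝ} (hmem : ψ ∈ szSector N M) (σ : Fin 2) (k : ℕ) :
    ∃ n : ℤ, |(if σ = 0 then (N : ℝ) / 2 + M else (N : ℝ) / 2 - M) / L - n| ≤
      max (lsmConst (2 * d) d t U μ g g k) (((lsmL0 (2 * d) t U μ : ℕ) : ℝ) ^ k / 2) / (L : ℝ) ^ k := by
  have hLpos : (0 : ℝ) < L := by exact_mod_cast Nat.pos_of_ne_zero (NeZero.ne L)
  by_cases hreg : lsmL0 (2 * d) t U μ ≤ L
  · obtain ⟨n, hn⟩ := hubbardTorus_filling_near_int_of_regime hd hg hreg hgap hψ hmem σ k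
    exact ⟨n, hn.trans (div_le_div_of_nonneg_right (le_max_left _ _) (by positivity))⟩
  · refine ⟨round ((if σ = 0 then (N : ℝ) / 2 + M else (N : ℝ) / 2 - M) / L), (abs_sub_round _).trans ?_⟩
    rw [le_div_iff₀ (by positivity)]
    have h1 : (L : ℝ) ^ k ≤ ((lsmL0 (2 * d) t U μ : ℕ) : ℝ) ^ k :=
      pow_le_pow_left₀ (by positivity) (by exact_mod_cast (not_le.1 hreg).le) k
    calc 1 / 2 * (L : ℝ) ^ k ≤ ((lsmL0 (2 * d) t U μ : ℕ) : ℝ) ^ k / 2 := by linarith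
      _ ≤ max (lsmConst (2 * d) d t U μ g g k) (((lsmL0 (2 * d) t U μ : ℕ) : ℝ) ^ k / 2) := le_max_right _ _

end TorusRate

end Literature.MathematicalPhysics.QuantumLattice

end
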